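import Literature.AlgebraicGeometry.Resolution.QuadraticTransformsUFD
import HarnessLib

/-!
# A regular local ring of positive dimension has a prime quotient which is a discrete valuation ring

For a regular local ring `(R, 𝔪)` of dimension `d ≥ 1` and a regular system of parameters
`x₁, …, x_d`, the ideal `𝔭 = (x₁, …, x_{d-1})` is prime and `R/𝔭` is a regular local ring of
dimension `1`, i.e. a discrete valuation ring (Matsumura, *Commutative Ring Theory*, Thm. 14.2:
"if `x₁, …, x_i` is part of a regular system of parameters then `R/(x₁, …, x_i)` is a regular
local ring of dimension `d - i`"; Thm. 14.3: regular local rings are domains; Thm. 11.2: a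
regular local ring of dimension `1` is a DVR). This file PROVES the existence statement in the
form needed to walk from a point of a regular scheme to the generic point through discrete
valuation rings (`exists_isPrime_isDiscreteValuationRing_quotient`): **there is a prime ideal
`𝔭 ≠ 𝔪` of `R` such that `R/𝔭` is a discrete valuation ring**, by induction on the dimension
with the one-element step `R ↦ R/(x)`, `x ∈ 𝔪 ∖ 𝔪²` of this tree
(`IsRegularLocalRing.quotient_span_singleton`, `Literature/AlgebraicGeometry/Resolution/RegularLocalRingsQuotient`)
and the principal ideal property in dimension `≤ 1`
(`isPrincipalIdealRing_of_ringKrullDim_le_one`, `…/QuadraticTransformsUFD`). Also recorded: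
the transport of `IsDiscreteValuationRing` along ring isomorphisms and the dimension-one case.
Mathlib searched (pin): `IsRegularLocalRing` (`RingTheory/RegularLocalRing/Defs`),
`IsDiscreteValuationRing` (no transport lemma along `RingEquiv`), `DoubleQuot.quotQuotEquivQuotOfLE`,
`RingEquiv.quotientBot`, `IsPrincipalIdealRing.of_surjective`, `IsLocalRing.of_surjective'`.

## References

* H. Matsumura, *Commutative Ring Theory*, Cambridge Studies in Advanced Mathematics 8 (1986):
  Thm. 11.2, Thm. 14.2, Thm. 14.3. [Matsumura1987]
-/

universe u

open IsLocalRing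

namespace Literature.RingTheory.RegularLocalRing

open Literature.AlgebraicGeometry.Resolution

variable {R : Type u} [CommRing R]

/-- `IsDiscreteValuationRing` is invariant under ring isomorphisms. [folklore] -/
theorem isDiscreteValuationRing_of_ringEquiv {S : Type u} [CommRing S] [IsDomain R] [IsDomain S]
    [IsDiscreteValuationRing R] (e : R ≃+* S) : IsDiscreteValuationRing S := by
  haveI : IsPrincipalIdealRing S := IsPrincipalIdealRing.of_surjective e.toRingHom e.surjective
  haveI : IsLocalRing S := e.isLocalRing
  refine { not_a_field' := ?_ }
  intro h
  apply IsDiscreteValuationRing.not_a_field R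
  rw [← map_ringEquiv_maximalIdeal e.symm, h, Ideal.map_bot]

/-- **A regular local ring of dimension one is a discrete valuation ring** (Matsumura, Thm. 11.2:
its maximal ideal is principal and non-zero, and the ring is a domain by Thm. 14.3).
[cite: Matsumura1987, Thm. 11.2] -/
theorem isDiscreteValuationRing_of_ringKrullDim_eq_one [IsRegularLocalRing R]
    (h : ringKrullDim R = 1) :
    haveI := isDomain_of_isRegularLocalRing R
    IsDiscreteValuationRing R := by
  haveI := isDomain_of_isRegularLocalRing R
  haveI : IsPrincipalIdealRing R := isPrincipalIdealRing_of_ringKrullDim_le_one h.le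
  refine { not_a_field' := ?_ }
  intro hbot
  have hf : IsField R := (isField_iff_maximalIdeal_eq).mpr hbot
  have h0 : ringKrullDim R = 0 := ringKrullDim_eq_zero_of_isField hf
  rw [h0] at h
  exact zero_ne_one h

/-- **A regular local ring of positive dimension has a prime ideal `𝔭` with `R/𝔭` a discrete
valuation ring** (Matsumura, Thm. 14.2 with Thm. 11.2: `𝔭 = (x₁, …, x_{d-1})` for a regular system
of parameters; here by induction on `d` through `R ↦ R/(x)`, `x ∈ 𝔪 ∖ 𝔪²`).
[cite: Matsumura1987, Thm. 14.2] -/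
theorem exists_isPrime_isDiscreteValuationRing_quotient (R : Type u) [CommRing R]
    [IsRegularLocalRing R] (h : ringKrullDim R ≠ 0) :
    ∃ (p : Ideal R) (_ : p.IsPrime), IsDiscreteValuationRing (R ⧸ p) := by
  obtain ⟨n, hn⟩ := exists_nat_cast_eq_ringKrullDim (R := R)
  induction n generalizing R with
  | zero => exact absurd hn (by rw [Nat.cast_zero]; exact h)
  | succ n ih =>
    rcases Nat.eq_zero_or_pos n with hz | hpos
    · -- dimension one: `𝔭 = 0`
      subst hz
      haveI := isDomain_of_isRegularLocalRing R
      haveI : IsDiscreteValuationRing R :=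
        isDiscreteValuationRing_of_ringKrullDim_eq_one (by rw [hn]; rfl)
      refine ⟨⊥, Ideal.isPrime_bot, ?_⟩
      exact isDiscreteValuationRing_of_ringEquiv (RingEquiv.quotientBot R).symm
    · -- dimension `≥ 2`: cut by `x ∈ 𝔪 ∖ 𝔪²` and induct
      obtain ⟨x, hx, hx2⟩ := IsRegularLocalRing.exists_not_mem_sq (R := R) h
      obtain ⟨hreg, hdim⟩ := IsRegularLocalRing.quotient_span_singleton hx hx2
      haveI := hreg
      have hdim' : ringKrullDim (R ⧸ Ideal.span {x}) = n := by
        obtain ⟨m, hm⟩ := exists_nat_cast_eq_ringKrullDim (R := R ⧸ Ideal.span {x})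
        rw [hm, hn] at hdim
        have : (m : WithBot ℕ∞) + 1 = ((m + 1 : ℕ) : WithBot ℕ∞) := by push_cast; rfl
        rw [this] at hdim
        have hmn : m + 1 = n + 1 := by exact_mod_cast hdim
        rw [hm]
        congr 1
        exact_mod_cast Nat.succ_injective hmn
      have hne : ringKrullDim (R ⧸ Ideal.span {x}) ≠ 0 := by
        rw [hdim']; exact_mod_cast hpos.ne'
      obtain ⟨n', rfl⟩ : ∃ n', n = n' + 1 := ⟨n - 1, (Nat.succ_pred_eq_of_pos hpos).symm⟩
      obtain ⟨p', hp', hdvr⟩ := ih (R ⧸ Ideal.span {x}) hne hdim'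
      haveI := hp'
      refine ⟨p'.comap (Ideal.Quotient.mk (Ideal.span {x})), inferInstance, ?_⟩
      have hle : Ideal.span {x} ≤ p'.comap (Ideal.Quotient.mk (Ideal.span {x})) := fun a ha => by
        rw [Ideal.mem_comap, Ideal.Quotient.eq_zero_iff_mem.mpr ha]
        exact zero_mem _
      have hmap : (p'.comap (Ideal.Quotient.mk (Ideal.span {x}))).map
          (Ideal.Quotient.mk (Ideal.span {x})) = p' :=
        Ideal.map_comap_of_surjective _ Ideal.Quotient.mk_surjective _
      let e : (R ⧸ Ideal.span {x}) ⧸ p' ≃+* R ⧸ p'.comap (Ideal.Quotient.mk (Ideal.span {x})) :=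
        (Ideal.quotEquivOfEq hmap.symm).trans (DoubleQuot.quotQuotEquivQuotOfLE hle)
      exact isDiscreteValuationRing_of_ringEquiv e

/-- The prime `𝔭` of `exists_isPrime_isDiscreteValuationRing_quotient` is not the maximal ideal
(`R/𝔭` is not a field), hence strictly smaller. [folklore] -/
theorem lt_maximalIdeal_of_isDiscreteValuationRing_quotient [IsLocalRing R] {p : Ideal R}
    [p.IsPrime] (hp : IsDiscreteValuationRing (R ⧸ p)) : p < maximalIdeal R := by
  refine lt_of_le_of_ne (IsLocalRing.le_maximalIdeal (Ideal.IsPrime.ne_top inferInstance)) ?_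
  intro hpm
  apply IsDiscreteValuationRing.not_a_field (R ⧸ p)
  haveI : (p : Ideal R).IsMaximal := hpm ▸ IsLocalRing.maximalIdeal.isMaximal R
  have hf : IsField (R ⧸ p) := (Ideal.Quotient.maximal_ideal_iff_isField_quotient p).mp inferInstance
  exact (isField_iff_maximalIdeal_eq).mp hf

end Literature.RingTheory.RegularLocalRing
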